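import Literature.NumberTheory.Automorphic.CompactCoreLevelPoint              -- ★ `IsCanonical.atPoint_eq_quotientMeasure`, ★ `OrbitalMeasureFamily.orbitalIntegral_atPoint`, ★ `compactCore_eq_univ`
import Literature.NumberTheory.Automorphic.ArchStableClassRegularTorus        -- ★ (V8)-glob FILE 2 (p838902): `archStableOrbitalIntegral_archDiagTorus_eq_sum`, `mk_archDiagTorus_eq_mk_iff`, `ncard_…`
import Literature.NumberTheory.Automorphic.ArchDiagonalTorusCentralizer       -- ★ D1′b₃ (p837122): `centralizer_archDiagTorus_eq_range`, `isCompact_range_archDiagTorus`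
import Literature.NumberTheory.Automorphic.UnitaryGroupArchTopology           -- ★ instances: `arch` locally compact, second countable, T₂
import Literature.NumberTheory.Rogawski1990.RegularEltLocalisation            -- ★ `isRegularElt_out_mk_arch`
import HarnessLib

/-!
# `Φ^st_∞` at a regular torus point of `G′_∞ = U(diag α)(L⁺ ⊗ ℝ)` with HONEST REPRESENTATIVES: point orbital integrals against `dν ∕ dt_prob`, the average over
# `Π_w S_N` with the factor `(Π_w p_w! q_w!)⁻¹`, and the sum over any transversal (Rogawski 1990 §4.1 (4.1.1) p. 39, §4.9 p. 54, §8.2 Prop. 8.2.1 p. 118)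

Topic `NumberTheory/Automorphic`; namespaces `Literature.NumberTheory.Automorphic` (§1, generic) and `….UnitaryGroup` (§§2–4).  THEOREMS ONLY (no definition, no instance, no
notation, no named fact, no `sorry`).  Cell `pub/hodgecm-mathlib`, ENGINE T1 (crux H413 = `stmt-HodgeConjecture-24833`); floor-1 preparation, count-neutral, under books rows #88 (ST-∞)
∕ #111 (S-d): road D2′, brick **«(V8)-orb»** (LEAD WORDS T7-44 ∕ T7-49, F0P3a-plan (g8), 2026-09-01; author F0P3a-p02 (g9)), sequel of ★ (V8)-glob `ArchStableClassRegularTorus`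
(p838902: `Φ^st_∞(t(z), a) = Σ_{q ∈ univ.image (ρ ↦ ⟦t(z∘ρ)⟧)} Φ(q, a)`).  There the summands are `classOrbitalIntegral m a q = orbitalIntegral (out q) a (m q)` at the CHOSEN
representative `out q` (★ `LocalOrbitalIntegral` :94); here they become honest orbital integrals AT THE TORUS POINTS `t(z ∘ ρ)` against the quotient of the Haar measure `ν` of
`G′_∞` by THE probability Haar measure of the compact torus `T_∞ = Z(t(z∘ρ))` — print's `Φ(γ′, f)` «with compatible measures» for `γ′ ∈ {γ, γ₁, γ₂}` (§8.2).

ROUTE (all ★): ★ `OrbitalMeasureFamily.orbitalIntegral_atPoint` (F0P3a-p06), ★ `IsCanonical.atPoint_eq_quotientMeasure` (`CompactCoreLevelPoint` :80 — a canonical family read AT THE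
POINT is `ν ∕ t′`, `t′` Haar with mass one on the compact core), ★ `compactCore_eq_univ`, Haar uniqueness, ★ `centralizer_archDiagTorus_eq_range` + ★ `isCompact_range_archDiagTorus`,
★ `isRegularElt_out_mk_arch`, ★ `isInvInvariant_of_compactSpace`.  A-p16 (g25)'s «D-S1g» `OrbitalMeasureCanonicalAtPoint` treats the general compact-OPEN core (non-archimedean tori);
here the hypotheses are `IsCompact Z(γ)` + `[IsProbabilityMeasure t]` — both heads coexist (LEAD T7-49).  PROBABILITY-HAAR TOKEN: the `∀ t`-form over `[t.IsHaarMeasure] [t.IsInvInvariant]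
[IsProbabilityMeasure t]` (hypotheses) + the existence lemma `exists_isHaarMeasure_isProbabilityMeasure_of_isCompact` (Mathlib `haarMeasure ⊤`), so nothing is vacuous.

WHAT IS PROVED.
* §1 (any locally compact second countable T₂ group `G`): `exists_isHaarMeasure_isProbabilityMeasure_of_isCompact`, `eq_of_isHaarMeasure_of_isProbabilityMeasure`, **(r1)
  `OrbitalMeasureFamily.IsCanonical.classOrbitalIntegral_mk_eq_orbitalIntegral_of_isCompact`**: `m` canonical for `(P, ν)`, `P (out ⟦γ⟧)`, `Z(γ)` compact, `t` any Haar probability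
  measure on `Z(γ)` ⇒ `classOrbitalIntegral m a ⟦γ⟧ = orbitalIntegral γ a (ν ∕ t)`.
* §2 (`G′_∞ = U(diag α)(L⁺ ⊗ ℝ)`, `α_i ≠ 0`, regular `z`): `isCompact_centralizer_archDiagTorus`, `isRegularElt_out_mk_archDiagTorus`.
* §3 COUNTING (any `m`, any `a`; `hherm : c α_i = α_i`): `sum_eq_card_fiber_smul_sum_image`, `card_fiber_mul_card_image_eq_card`, `exists_injOn_image_eq` (generic constant-fibre
  book-keeping and transversals); `card_filter_mk_archDiagTorus_eq` (all fibres of `ρ ↦ ⟦t(z∘ρ)⟧` on `Π_w S_N` have one size) and **`card_filter_mk_archDiagTorus_eq_prod_factorial`**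
  (that size is `K = Π_w p_w! (N − p_w)!`, `p_w = #{i ∣ re σ_w(α_i) > 0}` — from `K · Π_w C(N,p_w) = (N!)^{#W}` and ★ `ncard_conjClasses_stable_archDiagTorus`; no stabiliser theory);
  **(r2′) `archStableOrbitalIntegral_archDiagTorus_eq_inv_mul_sum_classOrbitalIntegral`**: `Φ^st_∞(t(z), a) = K⁻¹ · Σ_{ρ ∈ Π_w S_N} Φ(⟦t(z∘ρ)⟧, a)` and **(r2′-rep)
  `…_eq_sum_classOrbitalIntegral_of_transversal`**: `= Σ_{ρ ∈ S} Φ(⟦t(z∘ρ)⟧, a)` for any transversal `S` of the fibres.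
* §4 CANONICAL `m` on the regular classes for the Haar measure `ν` of `G′_∞` (★ `IsCanonical (fun γ => IsRegularElt γ.val) ν`): **(r1-arch)
  `classOrbitalIntegral_mk_archDiagTorus_eq_orbitalIntegral`** (`Φ(⟦t(z)⟧, a) = ∫_{G′_∞∕T_∞} a(x t(z) x⁻¹) d(ν∕t)`), **(r2) `archStableOrbitalIntegral_archDiagTorus_eq_inv_mul_sum_orbitalIntegral`**
  (`Φ^st_∞(t(z), a) = (Π_w p_w!(N−p_w)!)⁻¹ · Σ_{ρ} O_{t(z∘ρ)}(a)`; at one `(2,1)` place `= ½ Σ_{σ ∈ S₃} O_{t(z∘σ)}` — the symmetric, representative-free shape) and **(r2-rep)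
  `…_eq_sum_orbitalIntegral_of_transversal`** (`= Σ_{ρ ∈ S} O_{t(z∘ρ)}(a)`, print's `Σ_{γ′ ∈ {γ,γ₁,γ₂}} Φ(γ′, f)`).
CONSUMERS AT FLOOR 2: (L-use)∕(L-st) differentiate (r2)∕(r2-rep) along ★ `ArchTorusOneAngleCurve`; (ST-∞) compares (r2) on the two inner forms; the identification with ★ (V2′)
`ArchTorusOrbitalFunction`'s fixed-quotient term (torus-normalised `IsQuotientOf` families) is a separate brick.
JUNK AUDIT: `hz` necessary (a singular torus point has a larger block centraliser and (r1-arch)'s `P (out ⟦γ⟧)` fails); `IsCompact Z(γ)` necessary in §1 (a split torus has Haar-null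
compact core); `[t.IsInvInvariant]` is automatic on a compact group (★ `isInvInvariant_of_compactSpace`) but ★ `quotientMeasure` reads it as an instance.  HONEST LABEL: HC_CM is proved only
modulo the printed citations until rung 0 closes; this file is measure-theoretic book-keeping (count-neutral floor-1 preparation) and pays nothing by itself.

## References
* [Rogawski1990] J. D. Rogawski, *Automorphic Representations of Unitary Groups in Three Variables*, Ann. of Math. Stud. 123 (1990): §1.7 p. 6 («all measures on groups are Haar
  measures»), §3.7 Prop. 3.7.1 pp. 29–30, §4.1 (4.1.1) p. 39 (`Φ^st(γ,f) = Σ_{γ′} Φ(γ′,f)`, `{γ′}` representatives of the classes in `𝒪_st(γ)`), §4.3 (4.3.1) p. 43 (compatible measures),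
  §4.9 p. 54 (`Φ(γ, f) = ∫_{G_γ∖G} f(g⁻¹γg) dg`), §8.2 Prop. 8.2.1 p. 118 (`γ, γ₁, γ₂`), §14.3 p. 234.
* [DeitmarEchterhoff2014] A. Deitmar, S. Echterhoff, *Principles of Harmonic Analysis*, 2nd ed. (2014), Thm. 1.5.3; [Folland1995] G. B. Folland, *A Course in Abstract
  Harmonic Analysis* (1995), Thm. 2.49 (uniqueness of Haar measure).
* [BrockerTomDieck1985] Th. Bröcker, T. tom Dieck, *Representations of Compact Lie Groups*, GTM 98 (1985), Ch. IV (3.1)–(3.2).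
-/

set_option autoImplicit false

noncomputable section

open MeasureTheory Measure Set Matrix Equiv NumberField NumberField.InfinitePlace NumberField.mixedEmbedding TopologicalSpace Literature.MeasureTheory.Group
open scoped MatrixGroups ENNReal NNReal

namespace Literature.NumberTheory.Automorphic

/-! ## §1 Canonical families at a class with COMPACT centraliser: the member is the quotient by the Haar PROBABILITY measure -/

section CompactCentralizer

variable {G : Type*} [Group G] [TopologicalSpace G] [IsTopologicalGroup G] [LocallyCompactSpace G]
  [SecondCountableTopology G] [T2Space G] [MeasurableSpace G] [BorelSpace G]
  [∀ γ : G, MeasurableSpace (G ⧸ Subgroup.centralizer ({γ} : Set G))]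
  [∀ γ : G, BorelSpace (G ⧸ Subgroup.centralizer ({γ} : Set G))]

omit [LocallyCompactSpace G] [∀ γ : G, MeasurableSpace (G ⧸ Subgroup.centralizer ({γ} : Set G))]
  [∀ γ : G, BorelSpace (G ⧸ Subgroup.centralizer ({γ} : Set G))] in
/-- **On a compact centraliser there IS an inversion-invariant Haar probability measure** (Mathlib `haarMeasure ⊤`, normalised on the positive compact `⊤ = univ`;
inversion invariance by ★ `isInvInvariant_of_compactSpace`) — so the `∀ t`-statements below are never vacuous. [cite: Folland1995, Thm. 2.49] -/
theorem exists_isHaarMeasure_isProbabilityMeasure_of_isCompact (γ : G)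
    (hZ : IsCompact ((Subgroup.centralizer ({γ} : Set G) : Subgroup G) : Set G)) :
    ∃ t : Measure (Subgroup.centralizer ({γ} : Set G)), t.IsHaarMeasure ∧ t.IsInvInvariant ∧ IsProbabilityMeasure t := by
  haveI : CompactSpace (Subgroup.centralizer ({γ} : Set G)) := isCompact_iff_compactSpace.mp hZ
  haveI : SecondCountableTopology (Subgroup.centralizer ({γ} : Set G)) := TopologicalSpace.Subtype.secondCountableTopology _
  refine ⟨haarMeasure (⊤ : PositiveCompacts (Subgroup.centralizer ({γ} : Set G))), inferInstance,
    isInvInvariant_of_compactSpace _, ⟨?_⟩⟩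
  rw [← PositiveCompacts.coe_top]
  exact haarMeasure_self

omit [∀ γ : G, MeasurableSpace (G ⧸ Subgroup.centralizer ({γ} : Set G))]
  [∀ γ : G, BorelSpace (G ⧸ Subgroup.centralizer ({γ} : Set G))] in
/-- **Two Haar probability measures on a compact centraliser coincide** (Haar uniqueness: `t′ = haarScalarFactor t′ t • t`, and the scalar is `1` on `univ`).
[cite: Folland1995, Thm. 2.49] [cite: DeitmarEchterhoff2014, Thm. 1.5.3] -/
theorem eq_of_isHaarMeasure_of_isProbabilityMeasure (γ : G)
    (t t' : Measure (Subgroup.centralizer ({γ} : Set G))) [t.IsHaarMeasure] [IsProbabilityMeasure t] [t'.IsHaarMeasure] [IsProbabilityMeasure t'] :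
    t' = t := by
  haveI : IsClosed ((Subgroup.centralizer ({γ} : Set G) : Subgroup G) : Set G) := isClosed_coe_centralizer_singleton γ
  haveI : LocallyCompactSpace (Subgroup.centralizer ({γ} : Set G)) :=
    (isClosed_coe_centralizer_singleton γ).isClosedEmbedding_subtypeVal.locallyCompactSpace
  haveI : SecondCountableTopology (Subgroup.centralizer ({γ} : Set G)) := TopologicalSpace.Subtype.secondCountableTopology _
  have hk := Measure.isMulLeftInvariant_eq_smul t' t
  have hk1 : (Measure.haarScalarFactor t' t : ℝ≥0∞) = 1 := by
    have h := congrArg (fun μ : Measure (Subgroup.centralizer ({γ} : Set G)) => μ univ) hk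
    simp only [Measure.coe_nnreal_smul_apply, measure_univ, mul_one] at h
    exact h.symm
  rw [hk, ENNReal.coe_eq_one.1 hk1, one_smul]

/-- **(r1) A CANONICAL FAMILY AT A CLASS WITH COMPACT CENTRALISER, READ AT THE POINT**: `m` canonical for `(P, ν)`, `P (out ⟦γ⟧)`, `Z(γ)` COMPACT ⇒ for EVERY Haar probability
measure `t` on `Z(γ)`, `classOrbitalIntegral m a ⟦γ⟧ = orbitalIntegral γ a (ν ∕ t) = ∫_{G∕Z(γ)} a(x γ x⁻¹) d(ν∕t)` — AT `γ`, not at `out ⟦γ⟧` (★ `IsCanonical.atPoint_eq_quotientMeasure`, ★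
`orbitalIntegral_atPoint`, Haar uniqueness; A-p16's D-S1g is the compact-OPEN-core sibling). [cite: Rogawski1990, §4.3 (4.3.1) p. 43; §4.9 p. 54] [cite: DeitmarEchterhoff2014, Thm. 1.5.3] -/
theorem OrbitalMeasureFamily.IsCanonical.classOrbitalIntegral_mk_eq_orbitalIntegral_of_isCompact {P : G → Prop} {ν : Measure G}
    [ν.IsHaarMeasure] [ν.IsMulRightInvariant] {m : OrbitalMeasureFamily G} (hm : m.IsCanonical P ν) (γ : G)
    (hc : P (Quotient.out (ConjClasses.mk γ))) (hZ : IsCompact ((Subgroup.centralizer ({γ} : Set G) : Subgroup G) : Set G))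
    (t : Measure (Subgroup.centralizer ({γ} : Set G))) [t.IsHaarMeasure] [t.IsInvInvariant] [IsProbabilityMeasure t] (a : G → ℂ) :
    classOrbitalIntegral m a (ConjClasses.mk γ) =
      orbitalIntegral γ a (quotientMeasure (Subgroup.centralizer ({γ} : Set G)) t (isClosed_coe_centralizer_singleton γ) ν) := by
  obtain ⟨t', ht', hti', h1, hat⟩ := hm.atPoint_eq_quotientMeasure γ hc
  haveI : SMulInvariantMeasure G (G ⧸ Subgroup.centralizer ({(Quotient.out (ConjClasses.mk γ) : G)} : Set G)) (m (ConjClasses.mk γ)) := by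
    obtain ⟨t₀, ht₀, hti₀, -, hm₀⟩ := hm _ hc
    rw [hm₀]
    exact smulInvariantMeasure_quotientMeasure _ _ _ _
  haveI : CompactSpace (Subgroup.centralizer ({γ} : Set G)) := isCompact_iff_compactSpace.mp hZ
  rw [compactCore_eq_univ] at h1
  haveI : IsProbabilityMeasure t' := ⟨h1⟩
  have htt : t' = t := eq_of_isHaarMeasure_of_isProbabilityMeasure γ t t'
  subst htt
  rw [← OrbitalMeasureFamily.orbitalIntegral_atPoint, hat]

end CompactCentralizer

namespace UnitaryGroup

open Literature.LinearAlgebra.Matrix Literature.NumberTheory.Rogawski1990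

section Fibres

/-- Summing `f (F i)` over all `i` = summing over the image with the constant fibre multiplicity `K`. [cite: BrockerTomDieck1985, Ch. IV (3.2)] -/
theorem sum_eq_card_fiber_smul_sum_image {ι β M : Type*} [Fintype ι] [DecidableEq β] [AddCommMonoid M] (F : ι → β) (f : β → M) (K : ℕ)
    (hfib : ∀ i, (Finset.univ.filter fun j => F j = F i).card = K) :
    ∑ i, f (F i) = K • ∑ q ∈ Finset.univ.image F, f q := by
  rw [Finset.sum_comp f F, Finset.smul_sum]
  refine Finset.sum_congr rfl fun q hq => ?_
  obtain ⟨i, -, rfl⟩ := Finset.mem_image.mp hq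
  rw [hfib i]

/-- Constant fibre size `K` times the size of the image is the size of the domain. [cite: BrockerTomDieck1985, Ch. IV (3.2)] -/
theorem card_fiber_mul_card_image_eq_card {ι β : Type*} [Fintype ι] [DecidableEq β] (F : ι → β) (K : ℕ)
    (hfib : ∀ i, (Finset.univ.filter fun j => F j = F i).card = K) :
    K * (Finset.univ.image F).card = Fintype.card ι := by
  rw [← Finset.card_univ, Finset.card_eq_sum_card_image F Finset.univ, mul_comm, ← smul_eq_mul, ← Finset.sum_const]
  refine (Finset.sum_congr rfl fun q hq => ?_).symm
  obtain ⟨i, -, rfl⟩ := Finset.mem_image.mp hq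
  exact hfib i

/-- **A transversal of the fibres**: a finite set `S` of the domain on which `F` is injective and which meets every fibre (one representative per value).
[cite: BrockerTomDieck1985, Ch. IV (3.2)] -/
theorem exists_injOn_image_eq {ι β : Type*} [Fintype ι] [DecidableEq ι] [DecidableEq β] (F : ι → β) :
    ∃ S : Finset ι, Set.InjOn F ↑S ∧ S.image F = Finset.univ.image F := by
  classical
  have hsec : ∀ q ∈ Finset.univ.image F, ∃ i, F i = q := fun q hq => by
    obtain ⟨i, -, hi⟩ := Finset.mem_image.mp hq; exact ⟨i, hi⟩
  choose g hg using hsec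
  refine ⟨(Finset.univ.image F).attach.image fun q => g q.1 q.2, ?_, ?_⟩
  · rintro i hi j hj hij
    obtain ⟨q, -, rfl⟩ := Finset.mem_image.mp (Finset.mem_coe.mp hi)
    obtain ⟨q', -, rfl⟩ := Finset.mem_image.mp (Finset.mem_coe.mp hj)
    have h : (q : β) = q' := by rw [← hg q.1 q.2, ← hg q'.1 q'.2]; exact hij
    rw [Subtype.ext h]
  · ext q
    constructor
    · intro hq
      obtain ⟨i, -, rfl⟩ := Finset.mem_image.mp hq
      exact Finset.mem_image_of_mem F (Finset.mem_univ i)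
    · intro hq
      exact Finset.mem_image.mpr ⟨g q hq, Finset.mem_image.mpr ⟨⟨q, hq⟩, Finset.mem_attach _ _, rfl⟩, hg q hq⟩

end Fibres

/-! ## §2 The regular torus points of `G′_∞ = U(diag α)(L⁺ ⊗ ℝ)`: compact centralisers, regular representatives -/

section Torus

variable (L : Type) [Field L] [NumberField L] [IsCMField L] (N : ℕ) (α : Fin N → L)

/-- **The centraliser of a regular torus point is COMPACT** (it is the torus `T_∞ = range t`, ★ `centralizer_archDiagTorus_eq_range`, a continuous image of `(S¹)^{W×N}`,
★ `isCompact_range_archDiagTorus`). [cite: Rogawski1990, §3.1 p. 19; §8.2 Prop. 8.2.1 p. 118] [cite: BrockerTomDieck1985, Ch. IV (3.1)] -/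
theorem isCompact_centralizer_archDiagTorus (hα : ∀ i, α i ≠ 0) {z : {w : InfinitePlace L // IsComplex w} → Fin N → Circle}
    (hz : ∀ w, Function.Injective (z w)) :
    IsCompact ((Subgroup.centralizer ({archDiagTorus L N α z} : Set (arch (↥(maximalRealSubfield L)) L (IsCMField.complexConj L) N (diagonal α))) :
      Set (arch (↥(maximalRealSubfield L)) L (IsCMField.complexConj L) N (diagonal α)))) := by
  rw [centralizer_archDiagTorus_eq_range L N α hα hz, MonoidHom.coe_range]
  exact isCompact_range_archDiagTorus L N α

/-- A regular torus point is a regular element of `GL_N(L ⊗ ℝ)` (★ `isRegularElt_archDiagTorus_iff`), and so is the representative `out ⟦t(z)⟧` of its class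
(★ `isRegularElt_out_mk_arch`). [cite: Rogawski1990, §3.1 p. 19; §14.3 p. 234] -/
theorem isRegularElt_out_mk_archDiagTorus {z : {w : InfinitePlace L // IsComplex w} → Fin N → Circle} (hz : ∀ w, Function.Injective (z w)) :
    IsRegularElt ((Quotient.out (ConjClasses.mk (archDiagTorus L N α z))).val : GL (Fin N) (mixedSpace L)) :=
  isRegularElt_out_mk_arch ((isRegularElt_archDiagTorus_iff L N α z).mpr hz)

/-! ## §3 `Φ^st_∞(t(z), a)` as the AVERAGE over the full permutation orbit: equal fibres and the factor `Π_w p_w! q_w!` -/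

open scoped Classical in
/-- **All fibres of `ρ ↦ ⟦t(z ∘ ρ)⟧` on `Π_w S_N` have the same size** (`ρ ↦ ρ₀ρ` maps the fibre through `1` onto the fibre through `ρ₀`; ★ `mk_archDiagTorus_eq_mk_iff`).
[cite: Rogawski1990, §3.7 Prop. 3.7.1 pp. 29–30] [cite: BrockerTomDieck1985, Ch. IV (3.2)] -/
theorem card_filter_mk_archDiagTorus_eq (hα : ∀ i, α i ≠ 0) (hherm : ∀ i, (IsCMField.complexConj L (α i) : L) = α i)
    {z : {w : InfinitePlace L // IsComplex w} → Fin N → Circle} (hz : ∀ w, Function.Injective (z w))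
    (ρ₀ : {w : InfinitePlace L // IsComplex w} → Perm (Fin N)) :
    (Finset.univ.filter fun ρ : {w : InfinitePlace L // IsComplex w} → Perm (Fin N) =>
        ConjClasses.mk (archDiagTorus L N α fun w => z w ∘ ρ w) = ConjClasses.mk (archDiagTorus L N α fun w => z w ∘ ρ₀ w)).card =
      (Finset.univ.filter fun κ : {w : InfinitePlace L // IsComplex w} → Perm (Fin N) =>
        ConjClasses.mk (archDiagTorus L N α fun w => z w ∘ κ w) =
          ConjClasses.mk (archDiagTorus L N α fun w => z w ∘ (1 : {w : InfinitePlace L // IsComplex w} → Perm (Fin N)) w)).card := by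
  -- `⟦t(z ∘ ρ₀κ)⟧ = ⟦t(z ∘ ρ₀)⟧ ↔ ⟦t(z ∘ κ)⟧ = ⟦t(z ∘ 1)⟧` (translate the sign-pattern criterion by `ρ₀`)
  have hmul : ∀ κ : {w : InfinitePlace L // IsComplex w} → Perm (Fin N),
      ConjClasses.mk (archDiagTorus L N α fun w => z w ∘ (ρ₀ * κ) w) = ConjClasses.mk (archDiagTorus L N α fun w => z w ∘ ρ₀ w) ↔
        ConjClasses.mk (archDiagTorus L N α fun w => z w ∘ κ w) =
          ConjClasses.mk (archDiagTorus L N α fun w => z w ∘ (1 : {w : InfinitePlace L // IsComplex w} → Perm (Fin N)) w) := fun κ => by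
    rw [mk_archDiagTorus_eq_mk_iff L N α hα hherm hz (ρ₀ * κ) ρ₀, mk_archDiagTorus_eq_mk_iff L N α hα hherm hz κ 1]
    refine forall_congr' fun w => ?_
    rw [Pi.mul_apply, Perm.coe_mul, ← Finset.image_image, Pi.one_apply, Perm.coe_one, Finset.image_id]
    exact (Finset.image_injective (ρ₀ w).injective).eq_iff
  have hset : (Finset.univ.filter fun ρ : {w : InfinitePlace L // IsComplex w} → Perm (Fin N) =>
        ConjClasses.mk (archDiagTorus L N α fun w => z w ∘ ρ w) = ConjClasses.mk (archDiagTorus L N α fun w => z w ∘ ρ₀ w)) =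
      (Finset.univ.filter fun κ : {w : InfinitePlace L // IsComplex w} → Perm (Fin N) =>
        ConjClasses.mk (archDiagTorus L N α fun w => z w ∘ κ w) =
          ConjClasses.mk (archDiagTorus L N α fun w => z w ∘ (1 : {w : InfinitePlace L // IsComplex w} → Perm (Fin N)) w)).image
        fun κ => ρ₀ * κ := by
    ext ρ
    simp only [Finset.mem_filter, Finset.mem_image, Finset.mem_univ, true_and]
    constructor
    · intro h
      refine ⟨ρ₀⁻¹ * ρ, (hmul _).mp ?_, mul_inv_cancel_left ρ₀ ρ⟩
      rw [mul_inv_cancel_left]; exact h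
    · rintro ⟨κ, hκ, rfl⟩
      exact (hmul κ).mpr hκ
  rw [hset, Finset.card_image_of_injective _ (mul_right_injective ρ₀)]

open scoped Classical in
/-- **The common fibre size is `K = Π_w p_w! (N − p_w)!`** (`K · Π_w C(N, p_w) = (N!)^{#W}` by ★ `ncard_conjClasses_stable_archDiagTorus`, and `C(N,p)·p!·(N−p)! = N!`).
[cite: Rogawski1990, §3.7 Prop. 3.7.1 pp. 29–30] [cite: BrockerTomDieck1985, Ch. IV (3.2)] -/
theorem card_filter_mk_archDiagTorus_eq_prod_factorial (hα : ∀ i, α i ≠ 0) (hherm : ∀ i, (IsCMField.complexConj L (α i) : L) = α i)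
    {z : {w : InfinitePlace L // IsComplex w} → Fin N → Circle} (hz : ∀ w, Function.Injective (z w))
    (ρ₀ : {w : InfinitePlace L // IsComplex w} → Perm (Fin N)) :
    (Finset.univ.filter fun ρ : {w : InfinitePlace L // IsComplex w} → Perm (Fin N) =>
        ConjClasses.mk (archDiagTorus L N α fun w => z w ∘ ρ w) = ConjClasses.mk (archDiagTorus L N α fun w => z w ∘ ρ₀ w)).card =
      ∏ w : {w : InfinitePlace L // IsComplex w},
        (Finset.univ.filter fun i => 0 < (w.1.embedding (α i)).re).card.factorial *
          (N - (Finset.univ.filter fun i => 0 < (w.1.embedding (α i)).re).card).factorial := by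
  -- every fibre has the size `K` of the fibre through `1`
  have hfib := fun ρ₁ : {w : InfinitePlace L // IsComplex w} → Perm (Fin N) => card_filter_mk_archDiagTorus_eq L N α hα hherm hz ρ₁
  rw [hfib ρ₀]
  -- `K · #image = #(Π_w S_N)`
  have hKM := card_fiber_mul_card_image_eq_card
    (fun ρ : {w : InfinitePlace L // IsComplex w} → Perm (Fin N) => ConjClasses.mk (archDiagTorus L N α fun w => z w ∘ ρ w)) _ hfib
  -- `#image = ∏ C(N, p_w)` (★ (V8)-glob) and `#(Π_w S_N) = ∏ N!`
  have hcardimg : (Finset.univ.image fun ρ : {w : InfinitePlace L // IsComplex w} → Perm (Fin N) =>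
      ConjClasses.mk (archDiagTorus L N α fun w => z w ∘ ρ w)).card =
        ∏ w : {w : InfinitePlace L // IsComplex w}, Nat.choose N (Finset.univ.filter fun i => 0 < (w.1.embedding (α i)).re).card := by
    have h := ncard_conjClasses_stable_archDiagTorus L N α hα hherm hz
    rwa [conjClasses_stable_archDiagTorus_eq_range L N α hα hherm hz, ← Set.image_univ, ← Finset.coe_univ, ← Finset.coe_image,
      Set.ncard_coe_finset] at h
  have huniv : Fintype.card ({w : InfinitePlace L // IsComplex w} → Perm (Fin N)) = ∏ _w : {w : InfinitePlace L // IsComplex w}, N.factorial := by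
    rw [Fintype.card_pi]
    exact Finset.prod_congr rfl fun w _ => by rw [Fintype.card_perm, Fintype.card_fin]
  rw [hcardimg, huniv] at hKM
  -- compare with `∏ ((p_w! (N−p_w)!) · C(N,p_w)) = ∏ N!` and cancel
  have hle : ∀ w : {w : InfinitePlace L // IsComplex w}, (Finset.univ.filter fun i => 0 < (w.1.embedding (α i)).re).card ≤ N := fun w =>
    (Finset.card_filter_le _ _).trans (by rw [Finset.card_univ, Fintype.card_fin])
  have hprod : (∏ w : {w : InfinitePlace L // IsComplex w},
        (Finset.univ.filter fun i => 0 < (w.1.embedding (α i)).re).card.factorial *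
          (N - (Finset.univ.filter fun i => 0 < (w.1.embedding (α i)).re).card).factorial) *
      (∏ w : {w : InfinitePlace L // IsComplex w}, Nat.choose N (Finset.univ.filter fun i => 0 < (w.1.embedding (α i)).re).card) =
        ∏ _w : {w : InfinitePlace L // IsComplex w}, N.factorial := by
    rw [← Finset.prod_mul_distrib]
    refine Finset.prod_congr rfl fun w _ => ?_
    rw [mul_comm, ← mul_assoc, Nat.choose_mul_factorial_mul_factorial (hle w)]
  have hpos : 0 < ∏ w : {w : InfinitePlace L // IsComplex w}, Nat.choose N (Finset.univ.filter fun i => 0 < (w.1.embedding (α i)).re).card :=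
    Finset.prod_pos fun w _ => Nat.choose_pos (hle w)
  exact Nat.eq_of_mul_eq_mul_right hpos (hKM.trans hprod.symm)

variable [∀ g : ↥(arch (↥(maximalRealSubfield L)) L (IsCMField.complexConj L) N (diagonal α)),
    MeasurableSpace (↥(arch (↥(maximalRealSubfield L)) L (IsCMField.complexConj L) N (diagonal α)) ⧸
      Subgroup.centralizer ({g} : Set ↥(arch (↥(maximalRealSubfield L)) L (IsCMField.complexConj L) N (diagonal α))))]

open scoped Classical in
/-- **(r2′) `Φ^st_∞(t(z), a) = (Π_w p_w!(N−p_w)!)⁻¹ · Σ_{ρ ∈ Π_w S_N} Φ(⟦t(z ∘ ρ)⟧, a)`** for ANY family `m` and ANY `a` — representative-free, symmetric in `ρ` (each class is hit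
`Π_w p_w!(N−p_w)!` times; ★ (g4) + Mathlib `Finset.sum_comp`). [cite: Rogawski1990, §4.1 (4.1.1) p. 39; §8.2 Prop. 8.2.1 p. 118] [cite: BrockerTomDieck1985, Ch. IV (3.2)] -/
theorem archStableOrbitalIntegral_archDiagTorus_eq_inv_mul_sum_classOrbitalIntegral (hα : ∀ i, α i ≠ 0)
    (hherm : ∀ i, (IsCMField.complexConj L (α i) : L) = α i) {z : {w : InfinitePlace L // IsComplex w} → Fin N → Circle}
    (hz : ∀ w, Function.Injective (z w))
    (m : OrbitalMeasureFamily ↥(arch (↥(maximalRealSubfield L)) L (IsCMField.complexConj L) N (diagonal α)))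
    (a : ↥(arch (↥(maximalRealSubfield L)) L (IsCMField.complexConj L) N (diagonal α)) → ℂ) :
    archStableOrbitalIntegral L N (diagonal α) m a (archDiagTorus L N α z) =
      ((∏ w : {w : InfinitePlace L // IsComplex w},
          (Finset.univ.filter fun i => 0 < (w.1.embedding (α i)).re).card.factorial *
            (N - (Finset.univ.filter fun i => 0 < (w.1.embedding (α i)).re).card).factorial : ℕ) : ℂ)⁻¹ *
        ∑ ρ : {w : InfinitePlace L // IsComplex w} → Perm (Fin N), classOrbitalIntegral m a (ConjClasses.mk (archDiagTorus L N α fun w => z w ∘ ρ w)) := by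
  have hsum := sum_eq_card_fiber_smul_sum_image
    (fun ρ : {w : InfinitePlace L // IsComplex w} → Perm (Fin N) => ConjClasses.mk (archDiagTorus L N α fun w => z w ∘ ρ w))
    (classOrbitalIntegral m a) _ (card_filter_mk_archDiagTorus_eq_prod_factorial L N α hα hherm hz)
  beta_reduce at hsum
  have hKpos : ((∏ w : {w : InfinitePlace L // IsComplex w},
      (Finset.univ.filter fun i => 0 < (w.1.embedding (α i)).re).card.factorial *
        (N - (Finset.univ.filter fun i => 0 < (w.1.embedding (α i)).re).card).factorial : ℕ) : ℂ) ≠ 0 := by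
    rw [Nat.cast_ne_zero]
    exact (Finset.prod_pos fun w _ => Nat.mul_pos (Nat.factorial_pos _) (Nat.factorial_pos _)).ne'
  rw [hsum, nsmul_eq_mul, ← mul_assoc, inv_mul_cancel₀ hKpos, one_mul, archStableOrbitalIntegral_archDiagTorus_eq_sum L N α hα hherm hz m a]

open scoped Classical in
/-- **(r2′-rep) `Φ^st_∞(t(z), a) = Σ_{ρ ∈ S} Φ(⟦t(z∘ρ)⟧, a)` over ANY TRANSVERSAL `S ⊆ Π_w S_N` of the sign-pattern cosets** (`S` meets every class of the stable class once:
`F` injective on `S`, `F(S) = F(Π_w S_N)` for `F ρ = ⟦t(z∘ρ)⟧`; such `S` exist, `exists_injOn_image_eq`) — print's «`{γ′}` a set of representatives for the conjugacy classes within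
`𝒪_st(γ)`» (4.1.1); the literal rewrite of ★ (g4) (any `m`, any `a`). [cite: Rogawski1990, §4.1 (4.1.1) p. 39; §8.2 Prop. 8.2.1 p. 118] -/
theorem archStableOrbitalIntegral_archDiagTorus_eq_sum_classOrbitalIntegral_of_transversal (hα : ∀ i, α i ≠ 0)
    (hherm : ∀ i, (IsCMField.complexConj L (α i) : L) = α i) {z : {w : InfinitePlace L // IsComplex w} → Fin N → Circle}
    (hz : ∀ w, Function.Injective (z w))
    (m : OrbitalMeasureFamily ↥(arch (↥(maximalRealSubfield L)) L (IsCMField.complexConj L) N (diagonal α)))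
    (a : ↥(arch (↥(maximalRealSubfield L)) L (IsCMField.complexConj L) N (diagonal α)) → ℂ)
    (S : Finset ({w : InfinitePlace L // IsComplex w} → Perm (Fin N)))
    (hinj : Set.InjOn (fun ρ : {w : InfinitePlace L // IsComplex w} → Perm (Fin N) => ConjClasses.mk (archDiagTorus L N α fun w => z w ∘ ρ w)) ↑S)
    (himg : S.image (fun ρ : {w : InfinitePlace L // IsComplex w} → Perm (Fin N) => ConjClasses.mk (archDiagTorus L N α fun w => z w ∘ ρ w)) =
      Finset.univ.image fun ρ : {w : InfinitePlace L // IsComplex w} → Perm (Fin N) => ConjClasses.mk (archDiagTorus L N α fun w => z w ∘ ρ w)) :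
    archStableOrbitalIntegral L N (diagonal α) m a (archDiagTorus L N α z) =
      ∑ ρ ∈ S, classOrbitalIntegral m a (ConjClasses.mk (archDiagTorus L N α fun w => z w ∘ ρ w)) := by
  rw [archStableOrbitalIntegral_archDiagTorus_eq_sum L N α hα hherm hz m a, ← himg, Finset.sum_image hinj]

/-! ## §4 Honest point orbital integrals: canonical families on `G′_∞` at the regular torus classes -/

variable [MeasurableSpace (arch (↥(maximalRealSubfield L)) L (IsCMField.complexConj L) N (diagonal α))]
  [BorelSpace (arch (↥(maximalRealSubfield L)) L (IsCMField.complexConj L) N (diagonal α))]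
  [∀ g : ↥(arch (↥(maximalRealSubfield L)) L (IsCMField.complexConj L) N (diagonal α)),
    BorelSpace (↥(arch (↥(maximalRealSubfield L)) L (IsCMField.complexConj L) N (diagonal α)) ⧸
      Subgroup.centralizer ({g} : Set ↥(arch (↥(maximalRealSubfield L)) L (IsCMField.complexConj L) N (diagonal α))))]

/-- **(r1-arch) THE CLASS ORBITAL INTEGRAL AT A REGULAR TORUS CLASS IS THE ORBITAL INTEGRAL AT THE TORUS POINT against `dν ∕ dt_prob`**: for a family `m` CANONICAL on the regular
classes for the Haar measure `ν` of `G′_∞` (★ `IsCanonical (fun γ => IsRegularElt γ.val) ν`) and EVERY Haar probability measure `t` on the compact torus `Z(t(z)) = T_∞`: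
`Φ(⟦t(z)⟧, a) = ∫_{G′_∞ ∕ T_∞} a(x t(z) x⁻¹) d(ν∕t)(ẋ)` — print's `Φ(γ, f)` with «compatible measures» at a regular elliptic `γ` of the compact Cartan. [cite: Rogawski1990, §4.9 p. 54; §8.2 Prop. 8.2.1 p. 118]
[cite: DeitmarEchterhoff2014, Thm. 1.5.3] -/
theorem classOrbitalIntegral_mk_archDiagTorus_eq_orbitalIntegral (hα : ∀ i, α i ≠ 0)
    {ν : Measure (arch (↥(maximalRealSubfield L)) L (IsCMField.complexConj L) N (diagonal α))} [ν.IsHaarMeasure] [ν.IsMulRightInvariant]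
    {m : OrbitalMeasureFamily ↥(arch (↥(maximalRealSubfield L)) L (IsCMField.complexConj L) N (diagonal α))}
    (hm : m.IsCanonical (fun γ => IsRegularElt (γ.val : GL (Fin N) (mixedSpace L))) ν)
    {z : {w : InfinitePlace L // IsComplex w} → Fin N → Circle} (hz : ∀ w, Function.Injective (z w))
    (t : Measure (Subgroup.centralizer ({archDiagTorus L N α z} : Set (arch (↥(maximalRealSubfield L)) L (IsCMField.complexConj L) N (diagonal α)))))
    [t.IsHaarMeasure] [t.IsInvInvariant] [IsProbabilityMeasure t] (a : arch (↥(maximalRealSubfield L)) L (IsCMField.complexConj L) N (diagonal α) → ℂ) :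
    classOrbitalIntegral m a (ConjClasses.mk (archDiagTorus L N α z)) =
      orbitalIntegral (archDiagTorus L N α z) a (quotientMeasure _ t (isClosed_coe_centralizer_singleton _) ν) :=
  hm.classOrbitalIntegral_mk_eq_orbitalIntegral_of_isCompact _ (isRegularElt_out_mk_archDiagTorus L N α hz)
    (isCompact_centralizer_archDiagTorus L N α hα hz) t a

open scoped Classical in
/-- **(r2) `Φ^st_∞(t(z), a) = (Π_w p_w!(N−p_w)!)⁻¹ · Σ_{ρ ∈ Π_w S_N} O_{t(z∘ρ)}(a)` WITH HONEST POINT ORBITAL INTEGRALS** (`m` canonical on the regular classes for `ν`; `t ρ` any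
inversion-invariant Haar probability measures on the compact tori `Z(t(z∘ρ)) = T_∞`): `O_{t(z∘ρ)}(a) = ∫_{G′_∞∕T_∞} a(x t(z∘ρ) x⁻¹) d(ν∕t_ρ)`; at a `(2,1)` place `Φ^st = ½ Σ_{σ ∈ S₃} O_{t(z∘σ)}`
— the symmetric, representative-free shape. [cite: Rogawski1990, §4.1 (4.1.1) p. 39; §4.9 p. 54; §8.2 Prop. 8.2.1 p. 118] [cite: DeitmarEchterhoff2014, Thm. 1.5.3] -/
theorem archStableOrbitalIntegral_archDiagTorus_eq_inv_mul_sum_orbitalIntegral (hα : ∀ i, α i ≠ 0)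
    (hherm : ∀ i, (IsCMField.complexConj L (α i) : L) = α i) {z : {w : InfinitePlace L // IsComplex w} → Fin N → Circle}
    (hz : ∀ w, Function.Injective (z w))
    {ν : Measure (arch (↥(maximalRealSubfield L)) L (IsCMField.complexConj L) N (diagonal α))} [ν.IsHaarMeasure] [ν.IsMulRightInvariant]
    {m : OrbitalMeasureFamily ↥(arch (↥(maximalRealSubfield L)) L (IsCMField.complexConj L) N (diagonal α))}
    (hm : m.IsCanonical (fun γ => IsRegularElt (γ.val : GL (Fin N) (mixedSpace L))) ν)
    (t : ∀ ρ : {w : InfinitePlace L // IsComplex w} → Perm (Fin N),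
      Measure (Subgroup.centralizer ({archDiagTorus L N α fun w => z w ∘ ρ w} : Set (arch (↥(maximalRealSubfield L)) L (IsCMField.complexConj L) N (diagonal α)))))
    [∀ ρ, (t ρ).IsHaarMeasure] [∀ ρ, (t ρ).IsInvInvariant] [∀ ρ, IsProbabilityMeasure (t ρ)]
    (a : ↥(arch (↥(maximalRealSubfield L)) L (IsCMField.complexConj L) N (diagonal α)) → ℂ) :
    archStableOrbitalIntegral L N (diagonal α) m a (archDiagTorus L N α z) =
      ((∏ w : {w : InfinitePlace L // IsComplex w},
          (Finset.univ.filter fun i => 0 < (w.1.embedding (α i)).re).card.factorial *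
            (N - (Finset.univ.filter fun i => 0 < (w.1.embedding (α i)).re).card).factorial : ℕ) : ℂ)⁻¹ *
        ∑ ρ : {w : InfinitePlace L // IsComplex w} → Perm (Fin N),
          orbitalIntegral (archDiagTorus L N α fun w => z w ∘ ρ w) a (quotientMeasure _ (t ρ) (isClosed_coe_centralizer_singleton _) ν) := by
  rw [archStableOrbitalIntegral_archDiagTorus_eq_inv_mul_sum_classOrbitalIntegral L N α hα hherm hz m a]
  congr 1
  exact Finset.sum_congr rfl fun ρ _ =>
    classOrbitalIntegral_mk_archDiagTorus_eq_orbitalIntegral L N α hα hm (fun w => (hz w).comp (ρ w).injective) (t ρ) a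

open scoped Classical in
/-- **(r2-rep) `Φ^st_∞(t(z), a) = Σ_{ρ ∈ S} O_{t(z∘ρ)}(a)` over ANY TRANSVERSAL `S` with HONEST POINT ORBITAL INTEGRALS** (canonical `m`, inversion-invariant Haar probability measures
`t ρ` on the compact tori) — print's `Φ^st(γ, f) = Σ_{γ′ ∈ {γ, γ₁, γ₂}} Φ(γ′, f)` at a `(2,1)` place, `#S = Π_w C(N, p_w)`; the image-sum form (L-use) consumes (LEAD T7-49), next to the
`K⁻¹`-average (r2). [cite: Rogawski1990, §4.1 (4.1.1) p. 39; §4.9 p. 54; §8.2 Prop. 8.2.1 p. 118] [cite: DeitmarEchterhoff2014, Thm. 1.5.3] -/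
theorem archStableOrbitalIntegral_archDiagTorus_eq_sum_orbitalIntegral_of_transversal (hα : ∀ i, α i ≠ 0)
    (hherm : ∀ i, (IsCMField.complexConj L (α i) : L) = α i) {z : {w : InfinitePlace L // IsComplex w} → Fin N → Circle}
    (hz : ∀ w, Function.Injective (z w))
    {ν : Measure (arch (↥(maximalRealSubfield L)) L (IsCMField.complexConj L) N (diagonal α))} [ν.IsHaarMeasure] [ν.IsMulRightInvariant]
    {m : OrbitalMeasureFamily ↥(arch (↥(maximalRealSubfield L)) L (IsCMField.complexConj L) N (diagonal α))}
    (hm : m.IsCanonical (fun γ => IsRegularElt (γ.val : GL (Fin N) (mixedSpace L))) ν)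
    (t : ∀ ρ : {w : InfinitePlace L // IsComplex w} → Perm (Fin N),
      Measure (Subgroup.centralizer ({archDiagTorus L N α fun w => z w ∘ ρ w} : Set (arch (↥(maximalRealSubfield L)) L (IsCMField.complexConj L) N (diagonal α)))))
    [∀ ρ, (t ρ).IsHaarMeasure] [∀ ρ, (t ρ).IsInvInvariant] [∀ ρ, IsProbabilityMeasure (t ρ)]
    (a : ↥(arch (↥(maximalRealSubfield L)) L (IsCMField.complexConj L) N (diagonal α)) → ℂ)
    (S : Finset ({w : InfinitePlace L // IsComplex w} → Perm (Fin N)))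
    (hinj : Set.InjOn (fun ρ : {w : InfinitePlace L // IsComplex w} → Perm (Fin N) => ConjClasses.mk (archDiagTorus L N α fun w => z w ∘ ρ w)) ↑S)
    (himg : S.image (fun ρ : {w : InfinitePlace L // IsComplex w} → Perm (Fin N) => ConjClasses.mk (archDiagTorus L N α fun w => z w ∘ ρ w)) =
      Finset.univ.image fun ρ : {w : InfinitePlace L // IsComplex w} → Perm (Fin N) => ConjClasses.mk (archDiagTorus L N α fun w => z w ∘ ρ w)) :
    archStableOrbitalIntegral L N (diagonal α) m a (archDiagTorus L N α z) =
      ∑ ρ ∈ S, orbitalIntegral (archDiagTorus L N α fun w => z w ∘ ρ w) a (quotientMeasure _ (t ρ) (isClosed_coe_centralizer_singleton _) ν) := by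
  rw [archStableOrbitalIntegral_archDiagTorus_eq_sum_classOrbitalIntegral_of_transversal L N α hα hherm hz m a S hinj himg]
  exact Finset.sum_congr rfl fun ρ _ =>
    classOrbitalIntegral_mk_archDiagTorus_eq_orbitalIntegral L N α hα hm (fun w => (hz w).comp (ρ w).injective) (t ρ) a

end Torus

end UnitaryGroup

end Literature.NumberTheory.Automorphic
end
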